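import Summits.BirchSwinnertonDyer.BirchSwinnertonDyer.Theorems.Rank2Observatory2DescClRowCertLe
import Summits.BirchSwinnertonDyer.BirchSwinnertonDyer.Theorems.ShaPrimaryTransferFiniteShaComponentTransferSelmerCubicDoorComplex
import HarnessLib

/-!
# BirchSwinnertonDyer — the SEL2CUBIC Selmer cover, CLASS-GROUP-GENERAL form (any class number of the cubic
# `2`-division field): `#Sel⁽²⁾(E/ℚ) ≤ #admissible pairs`, valuation rows on Selmer classes, strict closing step

HONEST FRAMING: route `ShaPrimaryTransfer`, seat `bsd-line-spt-p1` (g29), `--supports` item T =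
`FiniteShaComponentTransfer` (stmt-22356), UNCHANGED (conjecture-grade at corank ≥ 2). BSD in rank ≥ 2 is NOT
proved by any of this. THEOREMS ONLY.

The class-group-general kernel `2`-descent of cell `b2b-bsdr2` (`Rank2Observatory2DescClVCover`,
`…ClRowCertLe`: modulus `M`, `Cl(𝓞 K)` generated by the ideals containing `M`, a `T`-unit family `W`) uses the
rational point only through «`ord_v(x − θ)` even at `v ∌ F′(θ)`»; the tree has this for every `2`-Selmer class
(`two_dvd_log_valuation_of_mem_selmerGroup`). Hence, verbatim with that input swapped:

* `sha_door_of_natCard_selmerGroup_two_lt` — `#Sel⁽²⁾ < 2^{r+1}` and `rank ≥ r` ⟹ `t₂ = 0 ∧ Ш[2^∞] = 0 ∧ rank = r`;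
* `exists_isSquare_descent_value_cl_sel` — `a · ∏_U W ∈ K²` for the Cassels class `[a]` of a Selmer class
  (`exists_tsupp_eq_mul_sq_of_closure_eq_top`);
* **`natCard_selmerGroup_le_of_coverSet_cl`** — `#Sel⁽²⁾(E/ℚ) ≤ #{admissible pairs}` for any sieve sound on
  Selmer classes;
* `valRow_sound_sel` — the valuation-parity rows are sound on Selmer classes;
* `Δ_shortModel_eq_sixteen_mul_disc` — `Δ(0, A, 0, B, C) = 16·disc`.
Consumed by `…SelmerCubicClRow` (the `checkLe` row door). [cite: Cassels1991LecturesEllipticCurves, §15]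
[cite: SilvermanAEC2009, Thm. X.4.2, Rem. X.4.1, Cor. X.4.4] [cite: CremonaAlgorithms1997, §3.6]
-/

-- single-conjunct summit: `Summit.BirchSwinnertonDyer.BirchSwinnertonDyer.…` repeats the name by design
set_option linter.dupNamespace false

noncomputable section

open scoped Classical NumberField nonZeroDivisors

open Literature.NumberTheory.NumberFields Literature.NumberTheory.EllipticCurves
  Literature.NumberTheory.GaloisRepresentations Polynomial Module NumberField IsDedekindDomain Ideal
open WeierstrassCurve WeierstrassCurve.Affine

namespace Summit.BirchSwinnertonDyer.BirchSwinnertonDyer.Theorems.ShaPrimaryTransferSelmerCubicCover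

open Summit.BirchSwinnertonDyer.BirchSwinnertonDyer.Rank2Observatory
open Summit.BirchSwinnertonDyer.BirchSwinnertonDyer.Rank2Observatory.TwoDescCubic
open Summit.BirchSwinnertonDyer.BirchSwinnertonDyer.Rank2Observatory.TwoDescCl
open Summit.BirchSwinnertonDyer.BirchSwinnertonDyer.Rank2Observatory.TwoDescCl.ClFieldCert

section Generic

variable {K : Type} [Field K] [NumberField K] {A B C : ℤ} {θ : 𝓞 K}

/-- **Closing step of a complete `2`-descent, strict form**: `#Sel⁽²⁾(E/K) < 2^{r+1}` together with
`rank E(K) ≥ r` gives `t₂(E) = 0`, `Ш(E/K)[2^∞] = 0` and `rank E(K) = r` (in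
`#Sel⁽²⁾ = 2^{rank}·#E(K)[2]·#Ш[2]` the factor `#Ш[2]` is `1`, else the count reaches `2^{r+1}`).
[cite: SilvermanAEC2009, Thm. X.4.2, Rem. X.4.1] -/
theorem sha_door_of_natCard_selmerGroup_two_lt (E : WeierstrassCurve K) [E.IsElliptic] {r : ℕ}
    (hlt : Nat.card (selmerGroup E 2) < 2 ^ (r + 1)) (hr : r ≤ E.mordellWeilRank) :
    E.shaCorank 2 = 0 ∧ AddCommGroup.primaryComponent E.sha 2 = ⊥ ∧ E.mordellWeilRank = r := by
  have hcount := E.natCard_selmerGroup_eq (n := 2) two_ne_zero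
  haveI : Finite (selmerGroup E 2) := E.finite_selmerGroup_holds (show (2 : ℤ) ≠ 0 by norm_num)
  have hSel : 1 ≤ Nat.card (selmerGroup E 2) := Nat.card_pos
  have hR : 2 ^ r ≤ 2 ^ E.mordellWeilRank := Nat.pow_le_pow_right (by norm_num) hr
  -- arithmetic: `N = R·T·S < 2·2^r ≤ 2R`, `N ≥ 1` ⟹ `S = 1`, `R < 2^{r+1}`
  have key : ∀ {N R T S : ℕ}, N = R * T * S → N < 2 ^ (r + 1) → 1 ≤ N → 2 ^ r ≤ R → S = 1 ∧ R < 2 ^ (r + 1) := by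
    intro N R T S h hlt' h1 hR'
    subst h
    have hT : 1 ≤ T := Nat.pos_of_ne_zero fun h0 => by simp [h0] at h1
    have hS : 1 ≤ S := Nat.pos_of_ne_zero fun h0 => by simp [h0] at h1
    refine ⟨?_, ?_⟩
    · by_contra hne
      have hS2 : 2 ≤ S := by omega
      have := Nat.mul_le_mul (Nat.mul_le_mul hR' hT) hS2
      rw [pow_succ] at hlt'
      omega
    · have := Nat.mul_le_mul (Nat.mul_le_mul (le_refl R) hT) hS
      rw [mul_one, mul_one] at this
      omega
  obtain ⟨hS, hRlt⟩ := key hcount hlt hSel hR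
  have hbot := AddSubgroup.eq_bot_of_card_eq _ hS
  have hrank : E.mordellWeilRank = r :=
    le_antisymm (Nat.lt_succ_iff.mp ((Nat.pow_lt_pow_iff_right (by norm_num)).mp hRlt)) hr
  exact ⟨E.shaCorank_eq_zero_of_inf_eq_bot 2 hbot, E.primaryComponent_sha_eq_bot_of_inf_eq_bot 2 hbot, hrank⟩

/-- **The `2`-descent value of a Selmer class is a square times an explicit `T`-unit product — class-group-general
form.** As `exists_isSquare_descent_value_cl` with the rational point replaced by a `2`-Selmer class: `M ≠ 0`
lying in every prime containing `F′(θ)`, the classes of the ideals containing `M` generating `Cl(𝓞 K)`, `W` a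
family absorbing every non-zero `T`-unit up to squares (`T = supp M`); then for `c ∈ Sel⁽²⁾(E/ℚ)` with Cassels
class `[a]`, `a · ∏_{j ∈ U} W j ∈ K²` for some `U` — since `ord_v(a)` is even at every `v ∌ F′(θ)`.
[cite: Cassels1991LecturesEllipticCurves, §15] [cite: SilvermanAEC2009, Prop. X.1.4, Cor. X.4.4] -/
theorem exists_isSquare_descent_value_cl_sel (E : WeierstrassCurve ℚ) [E.IsElliptic]
    (ha₁ : E.a₁ = 0) (ha₂ : E.a₂ = A) (ha₃ : E.a₃ = 0) (ha₄ : E.a₄ = B) (ha₆ : E.a₆ = C)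
    (hθ : aeval (algebraMap (𝓞 K) K θ) (MonicCubic.poly A B C) = 0) [(E.baseChange K).IsElliptic]
    {M : 𝓞 K} (hM : M ≠ 0)
    (hgen : Subgroup.closure {c : ClassGroup (𝓞 K) | ∃ (J : Ideal (𝓞 K))
      (hJ : J ∈ (Ideal (𝓞 K))⁰), M ∈ J ∧ ClassGroup.mk0 ⟨J, hJ⟩ = c} = ⊤)
    (hDM : ∀ v : HeightOneSpectrum (𝓞 K),
      (3 : 𝓞 K) * θ ^ 2 + 2 * (A : 𝓞 K) * θ + (B : 𝓞 K) ∈ v.asIdeal → M ∈ v.asIdeal)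
    {n : ℕ} {W : Fin n → 𝓞 K}
    (hW : ∀ u : K, u ≠ 0 →
      (∀ v : HeightOneSpectrum (𝓞 K), M ∉ v.asIdeal → v.valuation K u = 1) →
      ∃ U : Finset (Fin n), IsSquare (u * ∏ j ∈ U, algebraMap (𝓞 K) K (W j)))
    {c : galH1Torsion E 2} (hc : c ∈ selmerGroup E 2) (a : Kˣ)
    (ha : kummerEquiv K 2 (E.oneRootDescentH1 K (isTwoTorsionX_of_aeval E ha₁ ha₂ ha₃ ha₄ ha₆ hθ) c) =
      Additive.ofMul (QuotientGroup.mk a)) :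
    ∃ U : Finset (Fin n), IsSquare ((a : K) * ∏ j ∈ U, algebraMap (𝓞 K) K (W j)) := by
  have hξ : (a : K) ≠ 0 := a.ne_zero
  -- parity of `ord_v (a)` at the primes `v ∌ M` (they do not contain `F′(θ)`)
  have hval : ∀ v : HeightOneSpectrum (𝓞 K), M ∉ v.asIdeal → (2 : ℤ) ∣ WithZero.log (v.valuation K (a : K)) :=
    fun v hv => two_dvd_log_valuation_of_mem_selmerGroup E ha₁ ha₂ ha₃ ha₄ ha₆ hθ hc a ha v (fun hD => hv (hDM v hD))
  -- the descent: `a · z² = t`, `t` an integral `T`-unit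
  obtain ⟨z, t, hz, ht0, htM, hzt⟩ := exists_tsupp_eq_mul_sq_of_closure_eq_top M hM hgen hξ hval
  have htK : ((t : 𝓞 K) : K) ≠ 0 := RingOfIntegers.coe_ne_zero_iff.mpr ht0
  have htval : ∀ v : HeightOneSpectrum (𝓞 K), M ∉ v.asIdeal → v.valuation K (t : K) = 1 := by
    intro v hv
    rw [RingOfIntegers.coe_eq_algebraMap, HeightOneSpectrum.valuation_eq_one_iff_notMem]
    exact fun ht => hv (htM v ht)
  obtain ⟨U, r, hr⟩ := hW (t : K) htK htval
  refine ⟨U, r / z, ?_⟩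
  rw [div_mul_div_comm, ← hr, ← hzt]
  field_simp

/-- **`#Sel⁽²⁾(E/ℚ) ≤ #{admissible pairs}`, class-group-general form**: if the Boolean sieve `adm` accepts every
pair `(T, U)` with `a · ∏_T Wu · ∏_U W ∈ K²` for the Cassels class `[a]` of a `2`-Selmer class, then
`#Sel⁽²⁾(E/ℚ)` is at most the number of admissible pairs (`Φ` injective on `H¹(ℚ, E[2])`, irreducible `F`).
The Selmer-class form of `mordellWeilRank_le_of_coverSet_cl`. [cite: Cassels1991LecturesEllipticCurves, §15]
[cite: SilvermanAEC2009, Thm. X.4.2] -/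
theorem natCard_selmerGroup_le_of_coverSet_cl (E : WeierstrassCurve ℚ) [E.IsElliptic]
    (ha₁ : E.a₁ = 0) (ha₂ : E.a₂ = A) (ha₃ : E.a₃ = 0) (ha₄ : E.a₄ = B) (ha₆ : E.a₆ = C)
    (hirr : Irreducible (MonicCubic.polyQ A B C))
    (hθ : aeval (algebraMap (𝓞 K) K θ) (MonicCubic.poly A B C) = 0) (h3 : finrank ℚ K = 3)
    [(E.baseChange K).IsElliptic]
    {M : 𝓞 K} (hM : M ≠ 0)
    (hgen : Subgroup.closure {c : ClassGroup (𝓞 K) | ∃ (J : Ideal (𝓞 K))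
      (hJ : J ∈ (Ideal (𝓞 K))⁰), M ∈ J ∧ ClassGroup.mk0 ⟨J, hJ⟩ = c} = ⊤)
    (hDM : ∀ v : HeightOneSpectrum (𝓞 K),
      (3 : 𝓞 K) * θ ^ 2 + 2 * (A : 𝓞 K) * θ + (B : 𝓞 K) ∈ v.asIdeal → M ∈ v.asIdeal)
    {n : ℕ} {W : Fin n → 𝓞 K} (hW0 : ∀ j, W j ≠ 0)
    (hW : ∀ u : K, u ≠ 0 →
      (∀ v : HeightOneSpectrum (𝓞 K), M ∉ v.asIdeal → v.valuation K u = 1) →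
      ∃ U : Finset (Fin n), IsSquare (u * ∏ j ∈ U, algebraMap (𝓞 K) K (W j)))
    {Wu : Fin 0 → (𝓞 K)ˣ} {adm : Finset (Fin 0) → Finset (Fin n) → Bool}
    (hadm : ∀ c ∈ selmerGroup E 2, ∀ a : Kˣ,
      kummerEquiv K 2 (E.oneRootDescentH1 K (isTwoTorsionX_of_aeval E ha₁ ha₂ ha₃ ha₄ ha₆ hθ) c) =
        Additive.ofMul (QuotientGroup.mk a) →
      ∀ (T : Finset (Fin 0)) (U : Finset (Fin n)),
        IsSquare ((a : K) * (∏ i ∈ T, algebraMap (𝓞 K) K (Wu i)) * ∏ j ∈ U, algebraMap (𝓞 K) K (W j)) →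
        adm T U = true) :
    Nat.card (selmerGroup E 2) ≤ ((Finset.univ ×ˢ Finset.univ).filter
      (fun p : Finset (Fin 0) × Finset (Fin n) => adm p.1 p.2 = true)).card := by
  set hθ' := isTwoTorsionX_of_aeval E ha₁ ha₂ ha₃ ha₄ ha₆ hθ
  set Φ : galH1Torsion E 2 → SqUnits K := fun c => Additive.toMul (kummerEquiv K 2 (E.oneRootDescentH1 K hθ' c))
    with hΦ
  have hΦinj : Function.Injective Φ := by
    intro c c' h
    have h' : kummerEquiv K 2 (E.oneRootDescentH1 K hθ' c) = kummerEquiv K 2 (E.oneRootDescentH1 K hθ' c') :=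
      Additive.toMul.injective h
    exact E.oneRootDescentH1_injective (irreducible_twoDivision E ha₁ ha₂ ha₃ ha₄ ha₆ hirr) h3 hθ'
      ((kummerEquiv K 2).injective h')
  have hmem : ∀ c ∈ selmerGroup E 2, Φ c ∈ coverSet Wu W adm := by
    intro c hc
    obtain ⟨a, haΦ⟩ := QuotientGroup.mk_surjective (Φ c)
    have ha : kummerEquiv K 2 (E.oneRootDescentH1 K hθ' c) = Additive.ofMul (QuotientGroup.mk a) := by
      rw [haΦ]; rfl
    obtain ⟨U, hsqU⟩ := exists_isSquare_descent_value_cl_sel E ha₁ ha₂ ha₃ ha₄ ha₆ hθ hM hgen hDM hW hc a ha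
    have hsq : IsSquare ((a : K) * (∏ i ∈ (∅ : Finset (Fin 0)), algebraMap (𝓞 K) K (Wu i)) *
        ∏ j ∈ U, algebraMap (𝓞 K) K (W j)) := by
      simpa only [Finset.prod_empty, mul_one] using hsqU
    refine Finset.mem_image.mpr ⟨(∅, U), Finset.mem_filter.mpr
      ⟨Finset.mem_product.mpr ⟨Finset.mem_univ _, Finset.mem_univ _⟩, hadm c hc a ha ∅ U hsq⟩, ?_⟩
    set z := (∏ i ∈ (∅ : Finset (Fin 0)), algebraMap (𝓞 K) K (Wu i)) * ∏ j ∈ U, algebraMap (𝓞 K) K (W j)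
      with hzdef
    have hz : z ≠ 0 := by
      refine mul_ne_zero (Finset.prod_ne_zero_iff.mpr fun i _ => ?_) (Finset.prod_ne_zero_iff.mpr fun j _ => ?_)
      · exact RingOfIntegers.coe_ne_zero_iff.mpr (Units.ne_zero (Wu i))
      · exact RingOfIntegers.coe_ne_zero_iff.mpr (hW0 j)
    obtain ⟨r, hr⟩ := hsq
    have hξ : sqClass (a : K) = Φ c := by rw [← haΦ, sqClass_of_ne_zero a.ne_zero, Units.mk0_val]
    have hprod : sqClass (a : K) * sqClass z = 1 := by
      rw [← sqClass_mul a.ne_zero hz, hzdef, ← mul_assoc, hr, sqClass_mul_self]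
    show sqClass z = Φ c
    rw [← hξ]
    calc sqClass z = 1 * sqClass z := (SqUnits.one_mul _).symm
      _ = sqClass (a : K) * sqClass (a : K) * sqClass z := by rw [SqUnits.mul_self]
      _ = sqClass (a : K) * (sqClass (a : K) * sqClass z) := by rw [mul_assoc]
      _ = sqClass (a : K) := by rw [hprod, SqUnits.mul_one]
  haveI : Finite (selmerGroup E 2) := E.finite_selmerGroup_holds (by norm_num : (2 : ℤ) ≠ 0)
  calc Nat.card (selmerGroup E 2)
      ≤ Nat.card (coverSet Wu W adm : Set (SqUnits K)) :=
        Nat.card_le_card_of_injective (fun c => ⟨Φ c.1, hmem c.1 c.2⟩)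
          (fun c c' h => Subtype.ext (hΦinj (congrArg Subtype.val h)))
    _ = (coverSet Wu W adm).card := by rw [Nat.card_coe_set_eq, Set.ncard_coe_finset]
    _ ≤ _ := card_coverSet_le Wu W adm

/-- **Soundness of a valuation-parity row on Selmer classes** (the true Selmer condition at a prime
`v ∌ F′(θ)`): if `a · ∏_T Wu · ∏_U W ∈ K²` for the Cassels class `[a]` of a `2`-Selmer class, then the number of
`j ∈ U` with `ord_v(W j)` odd (the certified bit-vector `r`) is even — `ord_v(a)` is even
(`two_dvd_log_valuation_of_mem_selmerGroup`) and units have valuation `0`. The Selmer-class form of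
`valRow_sound`. [cite: Cassels1991LecturesEllipticCurves, §15] [cite: SilvermanAEC2009, Cor. X.4.4] -/
theorem valRow_sound_sel (E : WeierstrassCurve ℚ) [E.IsElliptic]
    (ha₁ : E.a₁ = 0) (ha₂ : E.a₂ = A) (ha₃ : E.a₃ = 0) (ha₄ : E.a₄ = B) (ha₆ : E.a₆ = C)
    (hθ : aeval (algebraMap (𝓞 K) K θ) (MonicCubic.poly A B C) = 0) [(E.baseChange K).IsElliptic]
    (v : HeightOneSpectrum (𝓞 K))
    (hderiv : (3 : 𝓞 K) * θ ^ 2 + 2 * (A : 𝓞 K) * θ + (B : 𝓞 K) ∉ v.asIdeal)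
    {n : ℕ} {W : Fin n → 𝓞 K} (hW0 : ∀ j, W j ≠ 0) {r : Fin n → Bool}
    (hr : ∀ j, r j = true ↔ ¬ (2 : ℤ) ∣ WithZero.log (v.valuation K (algebraMap (𝓞 K) K (W j))))
    {m : ℕ} {Wu : Fin m → (𝓞 K)ˣ}
    {c : galH1Torsion E 2} (hc : c ∈ selmerGroup E 2) (a : Kˣ)
    (ha : kummerEquiv K 2 (E.oneRootDescentH1 K (isTwoTorsionX_of_aeval E ha₁ ha₂ ha₃ ha₄ ha₆ hθ) c) =
      Additive.ofMul (QuotientGroup.mk a))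
    (T : Finset (Fin m)) (U : Finset (Fin n))
    (hsq : IsSquare ((a : K) * (∏ i ∈ T, algebraMap (𝓞 K) K (Wu i)) * ∏ j ∈ U, algebraMap (𝓞 K) K (W j))) :
    decide (Even (U.filter fun j => r j = true).card) = true := by
  rw [decide_eq_true_eq]
  have hξ : (a : K) ≠ 0 := a.ne_zero
  have hpar : (2 : ℤ) ∣ WithZero.log (v.valuation K (a : K)) :=
    two_dvd_log_valuation_of_mem_selmerGroup E ha₁ ha₂ ha₃ ha₄ ha₆ hθ hc a ha v hderiv
  -- valuations of the factors
  have hWu : ∀ i, WithZero.log (v.valuation K (algebraMap (𝓞 K) K (Wu i : 𝓞 K))) = 0 := by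
    intro i
    have h1 : v.valuation K (algebraMap (𝓞 K) K (Wu i : 𝓞 K)) = 1 :=
      (HeightOneSpectrum.valuation_eq_one_iff_notMem (v := v) (K := K)).mpr
        (fun h => v.isPrime.ne_top (Ideal.eq_top_of_isUnit_mem _ h (Wu i).isUnit))
    rw [h1, WithZero.log_one]
  have hne : ∀ w : K, w ≠ 0 → v.valuation K w ≠ 0 := fun w hw => (Valuation.ne_zero_iff _).mpr hw
  obtain ⟨q, hq⟩ := hsq
  have hT0 : (∏ i ∈ T, algebraMap (𝓞 K) K (Wu i : 𝓞 K)) ≠ 0 :=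
    Finset.prod_ne_zero_iff.mpr fun i _ => RingOfIntegers.coe_ne_zero_iff.mpr (Units.ne_zero (Wu i))
  have hU0 : (∏ j ∈ U, algebraMap (𝓞 K) K (W j)) ≠ 0 :=
    Finset.prod_ne_zero_iff.mpr fun j _ => RingOfIntegers.coe_ne_zero_iff.mpr (hW0 j)
  have hq0 : q ≠ 0 := by
    rintro rfl
    rw [mul_zero] at hq
    exact mul_ne_zero (mul_ne_zero hξ hT0) hU0 hq
  have key := congrArg (fun w => WithZero.log (v.valuation K w)) hq
  rw [map_mul, map_mul, WithZero.log_mul (mul_ne_zero (hne _ hξ) (hne _ hT0)) (hne _ hU0),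
    WithZero.log_mul (hne _ hξ) (hne _ hT0), map_mul, WithZero.log_mul (hne _ hq0) (hne _ hq0),
    log_valuation_prod v T _ (fun i _ => RingOfIntegers.coe_ne_zero_iff.mpr (Units.ne_zero (Wu i))),
    log_valuation_prod v U _ (fun j _ => RingOfIntegers.coe_ne_zero_iff.mpr (hW0 j))] at key
  simp only [hWu, Finset.sum_const_zero, add_zero] at key
  have heven : Even (∑ j ∈ U, WithZero.log (v.valuation K (algebraMap (𝓞 K) K (W j)))) := by
    obtain ⟨d, hd⟩ := hpar
    refine ⟨WithZero.log (v.valuation K q) - d, ?_⟩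
    linarith
  rw [even_sum_iff_even_card_filter_odd] at heven
  convert heven using 2
  refine Finset.filter_congr fun j _ => ?_
  rw [hr j, ← even_iff_two_dvd, Int.not_even_iff_odd]

/-- `Δ(0, A, 0, B, C) = 16 · disc(X³ + AX² + BX + C)`. [folklore] -/
theorem Δ_shortModel_eq_sixteen_mul_disc (A B C : ℤ) :
    ((⟨0, A, 0, B, C⟩ : WeierstrassCurve ℚ)).Δ = ((16 * MonicCubic.disc A B C : ℤ) : ℚ) := by
  rw [Δ_shortModel]
  have h : deltaShort A B C = 16 * MonicCubic.disc A B C := by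
    simp only [deltaShort, MonicCubic.disc]; ring
  rw [h]

end Generic

end Summit.BirchSwinnertonDyer.BirchSwinnertonDyer.Theorems.ShaPrimaryTransferSelmerCubicCover

end
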